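import Summits.QuantumFields.YangMills.Theorems.BalabanUVNodesN11TopPairLocalResidualPostR

/-!
EDITION v1.1 (dag-n11-d g31, 2026-08-29; T0′ of the FLAG №1 R2b cure): the proviso-keyed theorems take the DISPLAYED one-scale law `hzh` of the step-1 residuals (K1-face
theorem: as an extra hypothesis inside the run-indexed chain) instead of reading it off the row `zhLocal`, which the cure re-types IN PLACE to print's two-scale law; content unchanged.

# DAG node N11 — THE MAIN TERM AT EVERY PARAMETER WHOSE STEP-1 RESIDUAL IS ONE-SCALE (`hzh`, displayed), THE WHOLE SUB-TOWER: a history whose level-`k` piece `χ_k(s)·slot_k(s)` vanishes `dU`-a.e. has ALL its children's 𝐓-slots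
# and post-𝐑 slots vanishing `dV′`-a.e. (the one-step kernel transport respects a.e.-zero integrand families; [IV] (0.3) is pointwise); so at every `θ : Stage13HParams F 2` obeying
# `hzh` (NOT implied by K1⁹'s provisos since W2∕T1′) with [B16] Thm 1's `Sect2Form 1`, EVERY DESCENDANT of a top pair `(Ω₁,Λ₁) = (𝕋,𝕋)` — every history that was all-small at the first step — contributes
# NOTHING to any `ρ_k`, `1 ≤ k ≤ K` (a.e.): read straight off K1⁹'s (B) face + `hzh` along Theorem 1's runs (count-neutral, LOCATED)

HEADER — WORK-UNIT METADATA.  Cell `pub-ymgap`, YM-PLAN Track A (HUMAN RULING D-0062), seat `pub-ymgap-dag-n11-d` (g19; N11 [B14], s2), route `BalabanUVNodes`, item K1⁹ =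
stmt-QuantumFields-27364 (helper lane, `--kind proof --supports 27364 --as helper`, count-neutral).  [III] = [Balaban1988Convergent], [IV] = [Balaban1989LargeFieldI], [B16] =
[Balaban1989LargeFieldII], [B7] = [Balaban1985Averaging].  Over this seat's g19 `…N11TopPairLocalResidualPostR` (★★★★★ `sLaw₁₃CoPH_one_top_pair_degenerate_su2`, `slotsOfRecord_succ_apply_eq_zero_of_slotsT`),
g3's `Node00.TkNoExpansionStepSucc.transportK_congr_ae_family` ∕ `slotsTOfRecord_succ_apply`, r11's `Seq.init_Ω ∕ init_Λ`, RECORD 13 v1.7 `H` ∕ v1.8 `V` (`SLaw₁₃CoPH`, `sect2Form_stage13SepCoPH_iff`,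
`datumOfRecord₁₃SepCoPHV`), `B16.EndStatementBPrinted`, `B14Cor3.inInterval_of_le`.

WHY THIS FILE.  `…PostR` shows: at every `θ` obeying the displayed one-scale law `hzh` (`SU(2)`, guards) with `SLaw₁₃CoPH θ p 1`, the top pair's post-𝐑 slot of `ρ₁` is the zero function or vanishes a.e. on
`{χ₁ ≠ 0}` — either way the PIECE `χ₁(s)·slot₁(s)` vanishes `dV`-a.e.  def-T's step (†) reads the parent only through that piece: `slotT_{k+1}(s′)(V′) = ∫dU δ(ŪV′⁻¹)[w(s′)(U,V′)·χ_k(init s′)(U)·slot_k(init s′)(U)]`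
(`slotsTOfRecord_succ_apply`), and the one-step kernel transport sends `dU`-a.e.-zero integrand families to `dV′`-a.e.-zero transports (g3's `transportK_congr_ae_family`, through the
disintegration of product Haar measure along the averaging — `HaarAC`, `k < K`); [IV] (0.3) then kills the post-𝐑 slot pointwise.  By induction along `Seq.init` (which keeps `Ω₁, Λ₁`):
EVERY history `s` of length `k`, `1 ≤ k ≤ K`, with `Ω₁(s) = Λ₁(s) = 𝕋` has `χ_k(s)·slot_k(s) = 0` `dV`-a.e. — the effective densities `ρ_k = Σ_s χ_k(s)·slot_k(s)` never see, after the
first step, the configurations that were small there.  §4 reads this off K1⁹'s (B) conjunct along the runs of Theorem 1's window.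

WHAT THIS FILE PROVES (0 `def`, 0 `sorry`, standard axioms).  §1 (generic step weights ∕ selector, every parameter) ★★ `slotsT_succ_ae_zero_of_parent_piece_ae_zero` · ★★
`piece_succ_ae_zero_of_parent_piece_ae_zero` · `piece_ae_zero_of_degenerate`.  §2 ★★★ `descendants_piece_ae_zero_of_top_pairs` (induction along `init`: if every top pair's level-1 piece
vanishes a.e., so does the piece of every history of length `k ≤ K` with `Ω₁ = Λ₁ = 𝕋`).  §3 ★★★★★★ `descendants_dead_of_sLaw_one_su2` (every `θ : Stage13HParams F 2` obeying `hzh` (no proviso) +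
guards + `SLaw₁₃CoPH θ p 1`).  §4 ★★★★★★ `descendants_dead_of_endStatementBPrinted_su2` (K1⁹'s (B) conjunct + `hzh` ⇒ `∃ γ > 0`, along every run in the window with `1 ≤ K` and the guards, every
descendant of a top pair is dead at every level `≤ K`).

HONEST FRAMING.  A NECESSARY-CONDITION reading on the tree's own rows and objects (count-neutral, LOCATED; repair census in `…N11TopPairLocalResidual`'s header); nothing of Bałaban asserted
or refuted; K1⁹ NOT refuted (histories that were NOT all-small at the first step may carry every `ρ_k`); N11 NOT discharged; K1⁹ NOT closed; no registered stub touched; counts unmoved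
(typed 28∕28 · discharged 6∕27 · A 6∕28); NOT ℝ⁴ ∕ OS ∕ mass gap ∕ Clay.  No `sorry`, `axiom`, `def`, `instance`, `notation`.  Sources (SHAPE only): [III] Thm 1 p.262, (2.1) p.254,
(2.17)–(2.18) p.257, (3.1) p.264, (3.24)–(3.25) p.270; [IV] (0.3) p.176; [B16] Thm 1 p.355; [B7] (10) p.19, Prop. 2 (53) p.26.
-/

noncomputable section

open MeasureTheory
open scoped BigOperators Matrix.Norms.L2Operator

namespace Summit.QuantumFields.YangMills.Theorems.BalabanUVNodesN11TopPairDescendantsDead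

open Literature.MathematicalPhysics.QuantumFieldTheory.Balaban1983to89 T4Continuum Node00 Node00.Tk B14.Eq218Concrete B14.Sect3Decomp
open Literature.MathematicalPhysics.QuantumFieldTheory.Balaban1983to89.T4AveragingDisintegration (transportK kernelTransport)
open Literature.MathematicalPhysics.QuantumFieldTheory.Balaban1983to89.ExpMeanLog (deltaSU)
open B14.Eq213MaximalDomains (side)
open BalabanUVNodesN11TopPairLocalResidualPostR (slotsOfRecord_succ_apply_eq_zero_of_slotsT sLaw₁₃CoPH_one_top_pair_degenerate_su2)

variable {F : T4Family} {N : ℕ} [NeZero N]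

/-! ## §1. A dead parent has dead children (every parameter, every step weight, every selector) -/

section Step

variable (ν : Stage7Numerics) (τ : TowerNumerics) (E : B12.RunParams → ℝ) (w : StepWeightsOfRecord F N ν τ.M) (ppSel : PpSelOfRecord F ν τ.M)
  (p : B12.RunParams) (g : ℕ → ℝ)

/-- ★★ **A PARENT WHOSE PIECE `χ_k·slot_k` VANISHES `dU`-a.e. HAS EVERY CHILD's 𝐓-SLOT VANISHING `dV′`-a.e.** (`k < K`): def-T's (†) integrates `w(s′)(U,V′)·χ_k(init s′)(U)·slot_k(init s′)(U)`
along the averaging of record, and the one-step kernel transport respects `dU`-a.e.-zero integrand families (g3's `transportK_congr_ae_family`: product Haar measure disintegrates along the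
averaging). [cite: Balaban1988Convergent, (3.1) p.264, (3.24)–(3.25) p.270; Balaban1985Averaging, (10) p.19] -/
theorem slotsT_succ_ae_zero_of_parent_piece_ae_zero {k : ℕ} (hk : k < p.K) (s' : SeqOfRecord F ν τ.M g p.K (k + 1))
    (h : ∀ᵐ U ∂fieldMeasure (F.P p.K) k (SU N), chiSeqOfRecord F N ν τ.M g p.K k s'.init U * slotsOfRecord F N ν τ E w ppSel p g k s'.init U = 0) :
    ∀ᵐ V' ∂fieldMeasure (F.P p.K) (k + 1) (SU N), slotsTOfRecord F N ν τ E w ppSel p g (k + 1) s' V' = 0 := by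
  have hfam := transportK_congr_ae_family (avOfRecord_measurable F N p.K k) (avOfRecord_haarAC F N p.K k hk)
    (f := fun (V' : GaugeField (F.P p.K) (k + 1) (SU N)) (U : GaugeField (F.P p.K) k (SU N)) =>
      w p g k s' U V' * (chiSeqOfRecord F N ν τ.M g p.K k s'.init U * slotsOfRecord F N ν τ E w ppSel p g k s'.init U))
    (g := fun _ _ => (0 : ℝ)) (h.mono fun U hU V' => by simp only [hU, mul_zero])
  filter_upwards [hfam] with V' hV'
  have h0 : transportK (avOfRecord F N p.K k).avg (fun _ => (0 : ℝ)) V' = 0 := by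
    show kernelTransport _ _ _ (fun _ => (0 : ℝ)) V' = 0
    simp only [kernelTransport, integral_zero, mul_zero]
  rw [slotsTOfRecord_succ_apply]
  show transportK (avOfRecord F N p.K k).avg _ V' = 0
  rw [hV', h0]

/-- ★★ **… HENCE EVERY CHILD's PIECE `χ_{k+1}·slot_{k+1}` VANISHES `dV′`-a.e.** ([IV] (0.3) pointwise: the post-𝐑 slot vanishes wherever the 𝐓-slot does).
[cite: Balaban1989LargeFieldI, (0.3) p.176; Balaban1988Convergent, (2.18) p.257, (3.25) p.270] -/
theorem piece_succ_ae_zero_of_parent_piece_ae_zero {k : ℕ} (hk : k < p.K) (s' : SeqOfRecord F ν τ.M g p.K (k + 1))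
    (h : ∀ᵐ U ∂fieldMeasure (F.P p.K) k (SU N), chiSeqOfRecord F N ν τ.M g p.K k s'.init U * slotsOfRecord F N ν τ E w ppSel p g k s'.init U = 0) :
    ∀ᵐ V' ∂fieldMeasure (F.P p.K) (k + 1) (SU N),
      chiSeqOfRecord F N ν τ.M g p.K (k + 1) s' V' * slotsOfRecord F N ν τ E w ppSel p g (k + 1) s' V' = 0 := by
  filter_upwards [slotsT_succ_ae_zero_of_parent_piece_ae_zero ν τ E w ppSel p g hk s' h] with V' hV'
  rw [slotsOfRecord_succ_apply_eq_zero_of_slotsT ν τ E w ppSel p g s' V' hV', mul_zero]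

/-- **A DEGENERATE SLOT HAS AN a.e.-ZERO PIECE**: «`slot ≡ 0 ∨ slot = 0` a.e. on `{χ ≠ 0}`» ⇒ `χ·slot = 0` a.e. [cite: Balaban1988Convergent, (2.17)–(2.18) p.257 (bookkeeping)] -/
theorem piece_ae_zero_of_degenerate {n : ℕ} (χ T : Density (F.P p.K) n (SU N))
    (h : T = 0 ∨ ∀ᵐ V ∂fieldMeasure (F.P p.K) n (SU N), χ V ≠ 0 → T V = 0) :
    ∀ᵐ V ∂fieldMeasure (F.P p.K) n (SU N), χ V * T V = 0 := by
  rcases h with h0 | hae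
  · exact Filter.Eventually.of_forall fun V => by rw [h0, Pi.zero_apply, mul_zero]
  · filter_upwards [hae] with V hV
    by_cases hχ : χ V = 0
    · rw [hχ, zero_mul]
    · rw [hV hχ, mul_zero]

end Step

/-! ## §2. Induction along `init`: every descendant of a dead top pair is dead -/

section Descendants

variable (ν : Stage7Numerics) (τ : TowerNumerics) (E : B12.RunParams → ℝ) (w : StepWeightsOfRecord F N ν τ.M) (ppSel : PpSelOfRecord F ν τ.M)
  (p : B12.RunParams) (g : ℕ → ℝ)

/-- ★★★ **IF EVERY TOP PAIR's LEVEL-1 PIECE VANISHES a.e., SO DOES THE PIECE OF EVERY HISTORY OF LENGTH `k`, `1 ≤ k ≤ K`, WITH `Ω₁ = Λ₁ = 𝕋`** (induction along r11's `Seq.init`,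
which keeps `Ω₁`, `Λ₁`; §1 at each step `k < K`). [cite: Balaban1988Convergent, (2.1) p.254, (2.18) p.257, (3.24)–(3.25) p.270; Balaban1989LargeFieldI, (0.3) p.176] -/
theorem descendants_piece_ae_zero_of_top_pairs
    (hbase : ∀ s : SeqOfRecord F ν τ.M g p.K 1, s.Ω 1 = Set.univ → s.Λ 1 = Set.univ →
      ∀ᵐ V ∂fieldMeasure (F.P p.K) 1 (SU N), chiSeqOfRecord F N ν τ.M g p.K 1 s V * slotsOfRecord F N ν τ E w ppSel p g 1 s V = 0) :
    ∀ k : ℕ, 1 ≤ k → k ≤ p.K → ∀ s : SeqOfRecord F ν τ.M g p.K k, s.Ω 1 = Set.univ → s.Λ 1 = Set.univ →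
      ∀ᵐ V ∂fieldMeasure (F.P p.K) k (SU N), chiSeqOfRecord F N ν τ.M g p.K k s V * slotsOfRecord F N ν τ E w ppSel p g k s V = 0 := by
  intro k hk1
  induction k with
  | zero => exact absurd hk1 (by norm_num)
  | succ k ih =>
    intro hkK s hΩ hΛ
    rcases Nat.eq_zero_or_pos k with rfl | hkpos
    · exact hbase s hΩ hΛ
    · have hk' : 1 ≤ k := hkpos
      have hinitΩ : s.init.Ω 1 = Set.univ := by rw [Seq.init_Ω s le_rfl hk']; exact hΩ
      have hinitΛ : s.init.Λ 1 = Set.univ := by rw [Seq.init_Λ s le_rfl hk']; exact hΛ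
      exact piece_succ_ae_zero_of_parent_piece_ae_zero ν τ E w ppSel p g (lt_of_lt_of_le (Nat.lt_succ_self k) hkK) s
        (ih hk' ((Nat.le_succ k).trans hkK) s.init hinitΩ hinitΛ)

/-- … and then every such history's CHILDREN (`k < K`) have 𝐓-slots vanishing `dV′`-a.e. — the next 𝐓-law's (O3′) clauses along the sub-tower are all served vacuously.
[cite: Balaban1988Convergent, (3.24)–(3.25) p.270, Thm 1 p.262 (bookkeeping)] -/
theorem descendants_slotsT_ae_zero_of_top_pairs
    (hbase : ∀ s : SeqOfRecord F ν τ.M g p.K 1, s.Ω 1 = Set.univ → s.Λ 1 = Set.univ →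
      ∀ᵐ V ∂fieldMeasure (F.P p.K) 1 (SU N), chiSeqOfRecord F N ν τ.M g p.K 1 s V * slotsOfRecord F N ν τ E w ppSel p g 1 s V = 0)
    {k : ℕ} (hk1 : 1 ≤ k) (hkK : k < p.K) (s' : SeqOfRecord F ν τ.M g p.K (k + 1)) (hΩ : s'.Ω 1 = Set.univ) (hΛ : s'.Λ 1 = Set.univ) :
    ∀ᵐ V' ∂fieldMeasure (F.P p.K) (k + 1) (SU N), slotsTOfRecord F N ν τ E w ppSel p g (k + 1) s' V' = 0 :=
  slotsT_succ_ae_zero_of_parent_piece_ae_zero ν τ E w ppSel p g hkK s'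
    (descendants_piece_ae_zero_of_top_pairs ν τ E w ppSel p g hbase k hk1 hkK.le s'.init
      (by rw [Seq.init_Ω s' le_rfl hk1]; exact hΩ) (by rw [Seq.init_Λ s' le_rfl hk1]; exact hΛ))

end Descendants

/-! ## §3. `SU(2)`, guards only: at every parameter obeying `hzh` with [B16] Thm 1's `Sect2Form 1` the all-small sub-tower is dead -/

section SU2

variable {F : T4Family} (θ : Stage13HParams F 2) (p : B12.RunParams)

/-- (v1.1, T0′ of the FLAG №1 R2b cure: the DISPLAYED one-scale law `hzh` of the step-1 residuals replaces the proviso structure, whose row `zhLocal` the cure re-types to print's two-scale law.) ★★★★★★ **EVERY DESCENDANT OF A TOP PAIR IS DEAD**: for every `θ : Stage13HParams F 2` whose step-1 residuals obey `hzh` (no proviso read; name kept), under the numerics guards, `SLaw₁₃CoPH θ p 1` ⇒ for every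
`k` with `1 ≤ k ≤ K` and every history `s` of length `k` with `Ω₁(s) = Λ₁(s) = 𝕋` (the histories that were ALL-SMALL AT THE FIRST STEP), the piece `χ_k(s)·slot_k(s)` of `ρ_k` vanishes
`dV`-a.e.  The effective densities never see those configurations again. [cite: Balaban1988Convergent, Thm 1 p.262, (2.1) p.254, (2.18) p.257, (3.1)–(3.5) pp.264–265, (3.24)–(3.25) p.270, p.267; Balaban1989LargeFieldI, (0.3) p.176; Balaban1985Averaging, Prop. 2 (52)–(54) p.26] -/
theorem descendants_dead_of_sLaw_one_su2 (hzh : ∀ (Ω Λ : ℕ → Set (Site (F.P p.K) 0)) Y ω ω', ω 0 = ω' 0 → (θ.Zh p 1 Ω Λ).ζ0 0 Y ω = (θ.Zh p 1 Ω Λ).ζ0 0 Y ω') (hM : 1 ≤ θ.τ9.M) (hM₂ : 0 < θ.ν.M₂) (hK : 0 < p.K) {α₀ : ℝ} (hα : 0 < α₀)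
    (hα3 : (143 * (((((F.P p.K).d + 4 : ℕ) : ℝ)) ^ 2 / 4) ^ 2) * α₀ ≤ 1 / 3)
    (hα2 : 2 * α₀ ≤ 2 * deltaSU (Fin 2) / ((((F.P p.K).d + 4) * (F.P p.K).L : ℕ) : ℝ) ^ 2)
    (hαε : epsOfRecord θ.ν (gOfRecord₁₃ F 2 θ.toStage13Params p) 1 * (F.P p.K).eta 1 ^ 2 + 4 * (2 * deltaOfRecord θ.ν (gOfRecord₁₃ F 2 θ.toStage13Params p) 0 θ.A₁) ≤
      α₀ * (F.P p.K).eta 1 ^ 2)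
    (hαr : 2 * α₀ * (((F.P p.K).L : ℝ) ^ 1 * (F.P p.K).eta 1) ^ 2 ≤ 2 * θ.ν.εreg)
    (hε₁ : 0 < epsOfRecord θ.ν (gOfRecord₁₃ F 2 θ.toStage13Params p) 1 * (F.P p.K).eta 1 ^ 2) (hmK : 1 ≤ (F.P p.K).m + (F.P p.K).K) (hε : 0 < θ.ν.εreg)
    (hε3 : (143 * (((((F.P p.K).d + 4 : ℕ) : ℝ)) ^ 2 / 4) ^ 2) * θ.ν.εreg ≤ 1 / 3)
    (hε2 : 2 * θ.ν.εreg ≤ 2 * deltaSU (Fin 2) / ((((F.P p.K).d + 4) * (F.P p.K).L : ℕ) : ℝ) ^ 2)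
    (hM1 : 1 ≤ θ.ν.M₁) (h3 : 3 * side (F.P p.K).L θ.ν.M₁ 1 ≤ sideχ F θ.ν p (gOfRecord₁₃ F 2 θ.toStage13Params p) 0)
    (hSL : SLaw₁₃CoPH F 2 θ p 1) {k : ℕ} (hk1 : 1 ≤ k) (hkK : k ≤ p.K)
    (s : SeqOfRecord F θ.ν θ.τ9.M (gOfRecord₁₃ F 2 θ.toStage13Params p) p.K k) (hΩ : s.Ω 1 = Set.univ) (hΛ : s.Λ 1 = Set.univ) :
    ∀ᵐ V ∂fieldMeasure (F.P p.K) k (SU 2),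
      chiSeqOfRecord F 2 θ.ν θ.τ9.M (gOfRecord₁₃ F 2 θ.toStage13Params p) p.K k s V *
        slotsOfRecord F 2 θ.ν θ.τ9 (EOfRecord₁₃ F 2 θ.toStage13Params) (wOfRecord₉ F 2 θ.toStage9Params) θ.ppSel p (gOfRecord₁₃ F 2 θ.toStage13Params p) k s V = 0 :=
  descendants_piece_ae_zero_of_top_pairs θ.ν θ.τ9 (EOfRecord₁₃ F 2 θ.toStage13Params) (wOfRecord₉ F 2 θ.toStage9Params) θ.ppSel p (gOfRecord₁₃ F 2 θ.toStage13Params p)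
    (fun s₁ hΩ₁ hΛ₁ => piece_ae_zero_of_degenerate p _ _
      (sLaw₁₃CoPH_one_top_pair_degenerate_su2 θ p hzh hM hM₂ hK hα hα3 hα2 hαε hαr hε₁ hmK hε hε3 hε2 hM1 h3 hSL s₁ hΩ₁ hΛ₁)) k hk1 hkK s hΩ hΛ

/-- (v1.1, T0′ of the FLAG №1 R2b cure: the DISPLAYED one-scale law `hzh` of the step-1 residuals replaces the proviso structure, whose row `zhLocal` the cure re-types to print's two-scale law.) ★★★★★ **… AND THE NEXT 𝐓-LAWS ALONG THE SUB-TOWER ARE SERVED VACUOUSLY**: under the same hypotheses every child (`k < K`) of such a history has a 𝐓-slot vanishing `dV′`-a.e.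
[cite: Balaban1988Convergent, Thm 1 p.262, (3.24)–(3.25) p.270; Balaban1989LargeFieldI, (0.3) p.176] -/
theorem descendants_slotsT_dead_of_sLaw_one_su2 (hzh : ∀ (Ω Λ : ℕ → Set (Site (F.P p.K) 0)) Y ω ω', ω 0 = ω' 0 → (θ.Zh p 1 Ω Λ).ζ0 0 Y ω = (θ.Zh p 1 Ω Λ).ζ0 0 Y ω') (hM : 1 ≤ θ.τ9.M) (hM₂ : 0 < θ.ν.M₂) (hK : 0 < p.K) {α₀ : ℝ} (hα : 0 < α₀)
    (hα3 : (143 * (((((F.P p.K).d + 4 : ℕ) : ℝ)) ^ 2 / 4) ^ 2) * α₀ ≤ 1 / 3)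
    (hα2 : 2 * α₀ ≤ 2 * deltaSU (Fin 2) / ((((F.P p.K).d + 4) * (F.P p.K).L : ℕ) : ℝ) ^ 2)
    (hαε : epsOfRecord θ.ν (gOfRecord₁₃ F 2 θ.toStage13Params p) 1 * (F.P p.K).eta 1 ^ 2 + 4 * (2 * deltaOfRecord θ.ν (gOfRecord₁₃ F 2 θ.toStage13Params p) 0 θ.A₁) ≤
      α₀ * (F.P p.K).eta 1 ^ 2)
    (hαr : 2 * α₀ * (((F.P p.K).L : ℝ) ^ 1 * (F.P p.K).eta 1) ^ 2 ≤ 2 * θ.ν.εreg)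
    (hε₁ : 0 < epsOfRecord θ.ν (gOfRecord₁₃ F 2 θ.toStage13Params p) 1 * (F.P p.K).eta 1 ^ 2) (hmK : 1 ≤ (F.P p.K).m + (F.P p.K).K) (hε : 0 < θ.ν.εreg)
    (hε3 : (143 * (((((F.P p.K).d + 4 : ℕ) : ℝ)) ^ 2 / 4) ^ 2) * θ.ν.εreg ≤ 1 / 3)
    (hε2 : 2 * θ.ν.εreg ≤ 2 * deltaSU (Fin 2) / ((((F.P p.K).d + 4) * (F.P p.K).L : ℕ) : ℝ) ^ 2)
    (hM1 : 1 ≤ θ.ν.M₁) (h3 : 3 * side (F.P p.K).L θ.ν.M₁ 1 ≤ sideχ F θ.ν p (gOfRecord₁₃ F 2 θ.toStage13Params p) 0)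
    (hSL : SLaw₁₃CoPH F 2 θ p 1) {k : ℕ} (hk1 : 1 ≤ k) (hkK : k < p.K)
    (s' : SeqOfRecord F θ.ν θ.τ9.M (gOfRecord₁₃ F 2 θ.toStage13Params p) p.K (k + 1)) (hΩ : s'.Ω 1 = Set.univ) (hΛ : s'.Λ 1 = Set.univ) :
    ∀ᵐ V' ∂fieldMeasure (F.P p.K) (k + 1) (SU 2),
      slotsTOfRecord F 2 θ.ν θ.τ9 (EOfRecord₁₃ F 2 θ.toStage13Params) (wOfRecord₉ F 2 θ.toStage9Params) θ.ppSel p (gOfRecord₁₃ F 2 θ.toStage13Params p) (k + 1) s' V' = 0 :=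
  descendants_slotsT_ae_zero_of_top_pairs θ.ν θ.τ9 (EOfRecord₁₃ F 2 θ.toStage13Params) (wOfRecord₉ F 2 θ.toStage9Params) θ.ppSel p (gOfRecord₁₃ F 2 θ.toStage13Params p)
    (fun s₁ hΩ₁ hΛ₁ => piece_ae_zero_of_degenerate p _ _
      (sLaw₁₃CoPH_one_top_pair_degenerate_su2 θ p hzh hM hM₂ hK hα hα3 hα2 hαε hαr hε₁ hmK hε hε3 hε2 hM1 h3 hSL s₁ hΩ₁ hΛ₁)) hk1 hkK s' hΩ hΛ

end SU2

/-! ## §4. Read off K1⁹'s own (B) face -/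

section K1Face

variable {F : T4Family} (θ : Stage13HParams F 2) (h : θ.Provisos₁₃SepCoPH F 2) (v : Revision₁₃ F 2 θ h)

/-- ★★★★★★ **K1⁹'s (B) CONJUNCT ⇒ ALONG EVERY RUN IN THEOREM 1's WINDOW WITH `1 ≤ K` (guards at the run), EVERY HISTORY THAT WAS ALL-SMALL AT THE FIRST STEP IS DEAD AT EVERY LEVEL `≤ K`**: **(v1.1, T0′ of the FLAG №1 R2b cure: plus the DISPLAYED one-scale law of the step-1 residuals, an extra hypothesis inside the run-indexed chain.)**
`B16.EndStatementBPrinted (datumOfRecord₁₃SepCoPHV F 2 θ h v).C` ⇒ `∃ γ > 0, ∀ p`, `flow_p` in the `γ`-window → `1 ≤ p.K` → guards → for every `k` with `1 ≤ k ≤ p.K` and every history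
`s` of length `k` with `Ω₁(s) = Λ₁(s) = 𝕋`, `χ_k(s)·slot_k(s) = 0` `dV`-a.e. [cite: Balaban1989LargeFieldII, Thm 1 p.355; Balaban1988Convergent, Thm 1 p.262, (2.18) p.257, (3.24)–(3.25) p.270; Balaban1989LargeFieldI, (0.3) p.176; Balaban1985Averaging, Prop. 2 (52)–(54) p.26] -/
theorem descendants_dead_of_endStatementBPrinted_su2 (hB : B16.EndStatementBPrinted (datumOfRecord₁₃SepCoPHV F 2 θ h v).C) :
    ∃ γ : ℝ, 0 < γ ∧ ∀ p : B12.RunParams, ((datumOfRecord₁₃SepCoPHV F 2 θ h v).C p).flow.InInterval γ p.K → 1 ≤ p.K →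
      1 ≤ θ.τ9.M → 0 < θ.ν.M₂ → ∀ {α₀ : ℝ}, 0 < α₀ →
      (143 * (((((F.P p.K).d + 4 : ℕ) : ℝ)) ^ 2 / 4) ^ 2) * α₀ ≤ 1 / 3 →
      2 * α₀ ≤ 2 * deltaSU (Fin 2) / ((((F.P p.K).d + 4) * (F.P p.K).L : ℕ) : ℝ) ^ 2 →
      epsOfRecord θ.ν (gOfRecord₁₃ F 2 θ.toStage13Params p) 1 * (F.P p.K).eta 1 ^ 2 + 4 * (2 * deltaOfRecord θ.ν (gOfRecord₁₃ F 2 θ.toStage13Params p) 0 θ.A₁) ≤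
        α₀ * (F.P p.K).eta 1 ^ 2 →
      2 * α₀ * (((F.P p.K).L : ℝ) ^ 1 * (F.P p.K).eta 1) ^ 2 ≤ 2 * θ.ν.εreg →
      0 < epsOfRecord θ.ν (gOfRecord₁₃ F 2 θ.toStage13Params p) 1 * (F.P p.K).eta 1 ^ 2 → 1 ≤ (F.P p.K).m + (F.P p.K).K → 0 < θ.ν.εreg →
      (143 * (((((F.P p.K).d + 4 : ℕ) : ℝ)) ^ 2 / 4) ^ 2) * θ.ν.εreg ≤ 1 / 3 →
      2 * θ.ν.εreg ≤ 2 * deltaSU (Fin 2) / ((((F.P p.K).d + 4) * (F.P p.K).L : ℕ) : ℝ) ^ 2 →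
      1 ≤ θ.ν.M₁ → 3 * side (F.P p.K).L θ.ν.M₁ 1 ≤ sideχ F θ.ν p (gOfRecord₁₃ F 2 θ.toStage13Params p) 0 →
      (∀ (Ω Λ : ℕ → Set (Site (F.P p.K) 0)) Y ω ω', ω 0 = ω' 0 → (θ.Zh p 1 Ω Λ).ζ0 0 Y ω = (θ.Zh p 1 Ω Λ).ζ0 0 Y ω') →
      ∀ {k : ℕ}, 1 ≤ k → k ≤ p.K → ∀ s : SeqOfRecord F θ.ν θ.τ9.M (gOfRecord₁₃ F 2 θ.toStage13Params p) p.K k, s.Ω 1 = Set.univ → s.Λ 1 = Set.univ →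
        ∀ᵐ V ∂fieldMeasure (F.P p.K) k (SU 2),
          chiSeqOfRecord F 2 θ.ν θ.τ9.M (gOfRecord₁₃ F 2 θ.toStage13Params p) p.K k s V *
            slotsOfRecord F 2 θ.ν θ.τ9 (EOfRecord₁₃ F 2 θ.toStage13Params) (wOfRecord₉ F 2 θ.toStage9Params) θ.ppSel p (gOfRecord₁₃ F 2 θ.toStage13Params p) k s V = 0 := by
  obtain ⟨γ, hγ, hall⟩ := hB.1
  refine ⟨γ, hγ, fun p hflow hK1 hM hM₂ α₀ hα hα3 hα2 hαε hαr hε₁ hmK hε hε3 hε2 hM1 h3 hzh k hk1 hkK s hΩ hΛ => ?_⟩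
  have h2 : ((datumOfRecord₁₃SepCoPH F 2 θ h).C p).Sect2Form 1 := hall p hflow 1 hK1
  have hSL : SLaw₁₃CoPH F 2 θ p 1 := (sLaw₁₃CoPH_iff F 2 θ p 1).2 ((sect2Form_stage13SepCoPH_iff F 2 θ h p 1).1 h2)
  exact descendants_dead_of_sLaw_one_su2 θ p hzh hM hM₂ hK1 hα hα3 hα2 hαε hαr hε₁ hmK hε hε3 hε2 hM1 h3 hSL hk1 hkK s hΩ hΛ

end K1Face

end Summit.QuantumFields.YangMills.Theorems.BalabanUVNodesN11TopPairDescendantsDead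

end
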